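import Summits.HodgeConjecture.HodgeConjecture.Theorems.RigidUnwindingKummerEndgameFiniteEtaleTrivialisation

/-!
# Route RigidUnwinding — crux `UnwindingReduction` (stmt-HodgeConjecture-14767), line `birth`: STUB S1 `stub_rankLocallyConstant`

The registered stub S1 (`RankLocallyConstant`) of the skeleton
`Cruxes/UnwindingReduction/Lines/birth.lean` — **the rank of a flat family of operators on
`Hᵏ(Y_t(ℂ); ℂ)` is independent of the base point**: for a smooth projective family `f : 𝒴 ⟶ U` over
an open `U ↪ ℙ¹_ℂ` and a family of operators `e_t` commuting with flat continuation along every path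
(`Flat k k e` of the route frame), `rk e_s = rk e_t` for all complex points `s`, `t` of `U`.

Proof (the monodromy dictionary, no Hodge theory): `Rᵏ f_* ℂ` is a local system on `U(ℂ)`
(`isCohomologicallyLocallyTrivialOn_univ_of_isSmoothProjectiveFamily`; `U` is a smooth irreducible
quasi-projective curve, sibling file `RigidUnwindingKummerEndgameFiniteEtaleTrivialisation`), so
transport along a path `γ` from `s` to `t` — `U(ℂ)` is path connected — is a LINEAR INJECTION
`Hᵏ(Y_s) → Hᵏ(Y_t)` (`transportLinear`, `transportFun_injective`-style cancellation by `γ⁻¹`), and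
FLATNESS makes it carry `im e_s` into `im e_t` (`transportFun_mem_range_of_flat`); the same backwards.
The idempotency hypothesis of the registered statement is not used.

`stub_rankLocallyConstant` is the registered name; the registered signature is the skeleton-local
abbreviation `RankLocallyConstant` (not importable from `Theorems/`), so this file lands as a helper and
the line's lead closes S1 with `theorem stub_rankLocallyConstant : RankLocallyConstant :=
Theorems.rankLocallyConstant`. No definition, no named fact, no `sorry`; `HC_CM` plays no role here.

References: [VoisinHodgeI2002] C. Voisin, Hodge Theory and Complex Algebraic Geometry I, §9.2.1,
Thm. 9.3; [DeligneHodgeII1971] P. Deligne, Théorie de Hodge II, 4.1.1; [HatcherAT2002] §1.3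
Prop. 1.34.
-/

noncomputable section

-- mandated namespace of this single-conjunct summit (as in the sibling `Theorems/*` files)
set_option linter.dupNamespace false

open CategoryTheory AlgebraicGeometry TopologicalSpace
open Literature.AlgebraicGeometry.Motives Literature.AlgebraicGeometry.HodgeTheory
open Literature.AlgebraicTopology.SingularHomology

namespace Summit.HodgeConjecture.HodgeConjecture.Theorems

section RankTransport

variable {𝒴 U : SchemeOver ℂ} (f : 𝒴 ⟶ U) (k : ℕ)

/-- **Transport does not decrease the rank of a flat family of operators**: along a path `γ` of
`U(ℂ)` from `a` to `b`, `rk e_a ≤ rk e_b` — transport is a linear injection carrying `im e_a` into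
`im e_b` (`transportFun_mem_range_of_flat`). [cite: VoisinHodgeI2002, §9.2.1] -/
theorem finrank_range_le_of_flat
    (hU : IsCohomologicallyLocallyTrivialOn f (Set.univ : Set (ComplexPoints U)))
    (e : ∀ t : ComplexPoints U, complexBetti (fiberOver f t) k →ₗ[ℂ] complexBetti (fiberOver f t) k)
    (hflat : ∀ (s t : ComplexPoints U) (γ : Path s t) (α : complexBetti (fiberOver f s) k)
      (β : complexBetti (fiberOver f t) k),
      IsContinuationAlong γ α β → IsContinuationAlong γ (e s α) (e t β))
    {a b : (Set.univ : Set (ComplexPoints U))} (hfin : Module.Finite ℂ (complexBetti (fiberOver f b.1) k))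
    (γ : Path a b) :
    Module.finrank ℂ (LinearMap.range (e a.1)) ≤ Module.finrank ℂ (LinearMap.range (e b.1)) := by
  haveI := hfin
  -- the restriction of transport along `γ` to `im e_a → im e_b`
  have hmem : ∀ x : LinearMap.range (e a.1),
      transportLinear f k hU ⟦γ⟧ x.1 ∈ LinearMap.range (e b.1) := fun x => by
    rw [transportLinear_apply]
    exact transportFun_mem_range_of_flat f k hU e hflat γ x.2
  haveI : Module.Finite ℂ (LinearMap.range (e b.1)) :=
    Module.Finite.of_injective (LinearMap.range (e b.1)).subtype Subtype.val_injective
  -- the restriction of transport along `γ` to `im e_a → im e_b`, injective by transport back along `γ⁻¹`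
  refine LinearMap.finrank_le_finrank_of_injective
    (f := LinearMap.codRestrict (LinearMap.range (e b.1))
      (transportLinear f k hU ⟦γ⟧ ∘ₗ (LinearMap.range (e a.1)).subtype) hmem) fun x y hxy => ?_
  apply Subtype.ext
  have h : transportFun f k hU ⟦γ⟧ x.1 = transportFun f k hU ⟦γ⟧ y.1 := congrArg Subtype.val hxy
  have hx := congrArg (transportFun f k hU (Path.Homotopic.Quotient.symm ⟦γ⟧)) h
  rwa [← transportFun_trans, ← transportFun_trans, Path.Homotopic.Quotient.trans_symm,
    transportFun_refl, transportFun_refl] at hx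

end RankTransport

/-- **STUB S1 of crux `UnwindingReduction` (stmt-HodgeConjecture-14767), line `birth` — the rank of a
flat family of operators is independent of the base point** (the body of the skeleton's
`RankLocallyConstant`, verbatim): for a smooth projective family `f : 𝒴 ⟶ U`, `U ↪ ℙ¹_ℂ` open, and
operators `e_t` on `Hᵏ(Y_t(ℂ); ℂ)` commuting with flat continuation, `rk e_s = rk e_t` for all complex
points `s, t`. Proof: module docstring (two applications of `finrank_range_le_of_flat` along a path and
its reverse; `U(ℂ)` is path connected). [cite: VoisinHodgeI2002, §9.2.1 and Thm. 9.3]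
[cite: DeligneHodgeII1971, Théorème 4.1.1] -/
theorem rankLocallyConstant :
    ∀ (U 𝒴 : SchemeOver ℂ) (j : U ⟶ projectiveSpace 1 ℂ) (f : 𝒴 ⟶ U) (d k : ℕ)
      (e : ∀ t : ComplexPoints U, complexBetti (fiberOver f t) k →ₗ[ℂ] complexBetti (fiberOver f t) k),
      AlgebraicGeometry.IsOpenImmersion j.left → IsSmoothProjectiveFamily f d →
      (∀ t, e t ∘ₗ e t = e t) →
      (∀ (s t : ComplexPoints U) (γ : Path s t) (α : complexBetti (fiberOver f s) k)
          (β : complexBetti (fiberOver f t) k),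
          IsContinuationAlong γ α β → IsContinuationAlong γ (e s α) (e t β)) →
      ∀ s t : ComplexPoints U,
        Module.finrank ℂ (LinearMap.range (e s)) = Module.finrank ℂ (LinearMap.range (e t)) := by
  intro U 𝒴 j f d k e hj hf _ hflat s t
  -- the base `U ⊂ ℙ¹`: smooth of relative dimension `1`, irreducible, quasi-projective; `U(ℂ)` path
  -- connected; `Rᵏ f_* ℂ` a local system
  haveI := hj
  haveI : Nonempty U.left := ⟨s.pt⟩
  haveI : SmoothOfRelativeDimension 1 U.hom :=
    smoothOfRelativeDimension_one_of_isOpenImmersion_projectiveLine j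
  haveI : Smooth U.hom := SmoothOfRelativeDimension.smooth 1 U.hom
  haveI : LocallyOfFiniteType U.hom := inferInstance
  haveI : IrreducibleSpace U.left := irreducibleSpace_of_isOpenImmersion_projectiveLine j
  have hUqp : IsQuasiProjectiveOver U := isQuasiProjectiveOver_of_isOpenImmersion_projectiveLine j
  have hU := isCohomologicallyLocallyTrivialOn_univ_of_isSmoothProjectiveFamily f 1 hf hUqp
  haveI : ConnectedSpace (ComplexPoints U) := connectedSpace_complexPoints_of_irreducibleSpace U
  haveI : PathConnectedSpace (ComplexPoints U) :=
    pathConnectedSpace_complexPoints_of_smoothOfRelativeDimension U 1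
  haveI : PathConnectedSpace (Set.univ : Set (ComplexPoints U)) :=
    isPathConnected_iff_pathConnectedSpace.mp isPathConnected_univ
  -- a path from `s` to `t` and its reverse
  let γ : Path (⟨s, Set.mem_univ s⟩ : (Set.univ : Set (ComplexPoints U))) ⟨t, Set.mem_univ t⟩ :=
    PathConnectedSpace.somePath _ _
  have hfs : Module.Finite ℂ (complexBetti (fiberOver f s) k) := finite_complexBetti (hf.isSmoothProjective s) k
  have hft : Module.Finite ℂ (complexBetti (fiberOver f t) k) := finite_complexBetti (hf.isSmoothProjective t) k
  have h1 : Module.finrank ℂ (LinearMap.range (e s)) ≤ Module.finrank ℂ (LinearMap.range (e t)) :=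
    finrank_range_le_of_flat f k hU e hflat (a := ⟨s, Set.mem_univ s⟩) (b := ⟨t, Set.mem_univ t⟩) hft γ
  have h2 : Module.finrank ℂ (LinearMap.range (e t)) ≤ Module.finrank ℂ (LinearMap.range (e s)) :=
    finrank_range_le_of_flat f k hU e hflat (a := ⟨t, Set.mem_univ t⟩) (b := ⟨s, Set.mem_univ s⟩) hfs
      γ.symm
  exact le_antisymm h1 h2

end Summit.HodgeConjecture.HodgeConjecture.Theorems

end
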